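import Mathlib.Geometry.Manifold.ContMDiff.Defs
import Mathlib.Geometry.Manifold.MFDeriv.Basic
import Literature.Analysis.Complex.HolomorphicBanach
import Literature.Geometry.Kaehler.AtlasCocycle
import HarnessLib

/-!
# Holomorphic maps on open sets are smooth (complex and real `C^n`, every exponent)

Layer `Literature/Geometry/Kaehler` (complex manifolds charted on complex normed spaces with the
models `𝓘(ℂ, E)`; theorems only: no definitions, no named facts, no `sorry`).

A holomorphic map is usually *given* as a complex-differentiable map (`MDifferentiableOn` for the
complex models) on an OPEN subset of a complex manifold — a uniformisation `𝔹ⁿ ⊇ U → X^an`, a local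
section, a chart expression — while the calculus of differential forms (pull-back of smooth forms,
`extDeriv` of a pull-back, de Rham comparison) consumes real `C^∞` maps for the real models
`𝓘(ℝ, E)` on the same charts.  This file is the bridge, ON AN OPEN SET and for EVERY exponent
`n : ℕ∞ω` (so also `n = ω`, analytic in charts):

* `contDiffOn_of_differentiableOn_complex`: a complex-differentiable map from an open subset of a
  complex normed space to a complex Banach space is `C^n` over `ℂ` for every `n : ℕ∞ω`
  (Chae (1985), Thm 14.13: Fréchet differentiable on an open set ⇔ analytic, in the tree as
  `Literature.Analysis.Complex.HolomorphicBanach.analyticOnNhd_of_differentiableOn`; then Mathlib's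
  `AnalyticOnNhd.contDiffOn_of_completeSpace`); pointwise form
  `contDiffAt_of_eventually_differentiableAt_complex`;
* `contMDiffOn_of_mdifferentiableOn` (**main**): for manifolds `M`, `M'` charted on complex normed
  spaces `E`, `E'` (`E'` complete) with `C^n` complex atlases, a map `f : M → M'` which is
  complex-differentiable on an open set `s` is complex-`C^n` on `s`; read in any pair of extended
  charts (Mathlib `mdifferentiableOn_iff` / `contMDiffOn_iff`) the chart expression is a
  complex-differentiable map between open sets, to which the first item applies (Voisin (2002),
  §1.2.1, Thm. 1.17: holomorphic ⇔ analytic; Gunning–Rossi Ch. I §A); pointwise form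
  `contMDiffAt_of_eventually_mdifferentiableAt`, global form `contMDiff_of_mdifferentiable`
  (every exponent; the tree's `MDifferentiable.contMDiff_of_complex` in
  `Literature/NumberTheory/Transcendental/ComplexFormsPullback.lean` is the global form at `n = ∞`
  for `C^ω` atlases);
* `contMDiffOn_real_of_mdifferentiableOn`, `contMDiffAt_real_of_eventually_mdifferentiableAt`,
  `contMDiff_real_of_mdifferentiable`: the same conclusions for the REAL models `𝓘(ℝ, E)`,
  `𝓘(ℝ, E')` on the same charts (by `Literature.Geometry.Kaehler.contMDiffOn_real_of_complex`:
  the extended charts are the same partial equivalences and `ContDiffWithinAt` restricts scalars)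
  — the form consumed by `MForm.pullbackWithin` / `extDeriv` computations along a uniformisation;
* `isManifold_of_isManifold_one_complex`: a complex atlas whose transition maps are complex-`C¹`
  is complex-`C^n` for every `n` (in particular `C^ω`): holomorphic transition maps are analytic.
  Deliberately a theorem, not an instance.

Exponent bookkeeping: the atlases are only assumed `C^n` for the TARGET exponent `n`
(`[IsManifold 𝓘(ℂ, E) n M] [IsManifold 𝓘(ℂ, E') n M']`); for `n = 0` the statement is continuity,
for `n ≠ 0` the `C¹` compatibility needed to read differentiability in a fixed pair of charts is
obtained by `IsManifold.of_le`.  With Mathlib's instances, `C^ω` atlases (e.g. the tree's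
`HodgeModel.isManifold`) and the model space itself (`f : E → M'` from an open subset of `E = ℂᵐ`)
qualify for every `n`.

What is NOT here: Hartogs' separate analyticity (the hypothesis is joint Fréchet
differentiability, as in Mathlib's `MDifferentiableOn`), infinite-dimensional source models for the
manifold statements beyond what `HolomorphicBanach` already gives (the source model `E` is an
arbitrary complex normed space here too), and any statement about the real-analytic class.

## References

* S. B. Chae, *Holomorphy and Calculus in Normed Spaces* (1985), Thm 14.13 (with 12.3).
* C. Voisin, *Hodge Theory and Complex Algebraic Geometry I* (2002), §1.2.1 Thm. 1.17, §2.2.1.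
* R. C. Gunning, H. Rossi, *Analytic Functions of Several Complex Variables* (1965), Ch. I §A.
* K. Fritzsche, H. Grauert, *From Holomorphic Functions to Complex Manifolds* (2002), Ch. I §2,
  Ch. IV §1.
-/

open scoped Manifold ContDiff Topology
open Set

namespace Literature.Geometry.Kaehler

/-! ### Normed spaces: complex differentiable on an open set ⇒ `C^n` for every `n : ℕ∞ω` -/

section NormedSpace

variable {E F : Type*} [NormedAddCommGroup E] [NormedSpace ℂ E] [NormedAddCommGroup F]
  [NormedSpace ℂ F] [CompleteSpace F]

/-- **Holomorphic on an open set ⇒ `C^n` for every exponent**, `n : ℕ∞ω` (so also `C^ω`): a map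
from an open subset `U` of a complex normed space to a complex Banach space which is (Fréchet)
complex-differentiable on `U` is `C^n` over `ℂ` on `U`.  Chae (1985), Thm 14.13 ((a) ⇒ (b):
differentiable ⇒ analytic, the tree's
`Literature.Analysis.Complex.HolomorphicBanach.analyticOnNhd_of_differentiableOn`), then
`AnalyticOnNhd.contDiffOn_of_completeSpace`.  (The tree's
`Literature.Analysis.Complex.HolomorphicBanach.contDiffOn_of_differentiableOn` is the same for
exponents `n : ℕ∞` only.) [cite: Chae1985, Thm 14.13] -/
theorem contDiffOn_of_differentiableOn_complex {f : E → F} {U : Set E}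
    (hf : DifferentiableOn ℂ f U) (hU : IsOpen U) {n : ℕ∞ω} : ContDiffOn ℂ n f U :=
  (Literature.Analysis.Complex.HolomorphicBanach.analyticOnNhd_of_differentiableOn hf
    hU).contDiffOn_of_completeSpace

/-- Pointwise form: a map which is complex-differentiable at every point of a neighbourhood of `x`
is `C^n` at `x` over `ℂ` for every `n : ℕ∞ω`. [cite: Chae1985, Thm 14.13] -/
theorem contDiffAt_of_eventually_differentiableAt_complex {f : E → F} {x : E}
    (hf : ∀ᶠ y in 𝓝 x, DifferentiableAt ℂ f y) {n : ℕ∞ω} : ContDiffAt ℂ n f x := by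
  obtain ⟨U, hUf, hU, hxU⟩ := eventually_nhds_iff.1 hf
  exact (contDiffOn_of_differentiableOn_complex (fun y hy ↦ (hUf y hy).differentiableWithinAt)
    hU).contDiffAt (hU.mem_nhds hxU)

end NormedSpace

/-! ### Exponent bookkeeping in `ℕ∞ω` -/

/-- In `ℕ∞ω = WithTop ℕ∞`, a non-zero exponent is at least `1` (private exponent bookkeeping).
[folklore] -/
private theorem one_le_of_ne_zero_withTopENat {n : ℕ∞ω} (hn : n ≠ 0) : 1 ≤ n := by
  induction n with
  | top => exact le_top
  | coe m =>
    have hm : m ≠ 0 := fun h ↦ hn (by simp [h])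
    exact_mod_cast (Order.one_le_iff_ne_zero.2 hm : (1 : ℕ∞) ≤ m)

/-! ### Complex manifolds: holomorphic on an open set ⇒ complex `C^n` -/

section Manifold

variable {E E' : Type*} [NormedAddCommGroup E] [NormedSpace ℂ E] [NormedAddCommGroup E']
  [NormedSpace ℂ E'] [CompleteSpace E']
  {M : Type*} [TopologicalSpace M] [ChartedSpace E M]
  {M' : Type*} [TopologicalSpace M'] [ChartedSpace E' M']
  {n : ℕ∞ω} {f : M → M'} {s : Set M} {x : M}

/-- **Holomorphic maps on open sets are complex-`C^n`** (main theorem).  `M`, `M'` are charted on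
complex normed spaces `E`, `E'` (`E'` complete) with complex-`C^n` atlases
(`IsManifold 𝓘(ℂ, E) n M`, `IsManifold 𝓘(ℂ, E') n M'`); if `f : M → M'` is complex-differentiable
(`MDifferentiableOn` for the complex models) on an OPEN set `s`, then `f` is complex-`C^n` on `s`,
for the given `n : ℕ∞ω` — in particular `C^∞` and `C^ω`.  Proof: for `n = 0` this is continuity;
for `n ≠ 0` the atlases are `C¹`, so differentiability can be read in any fixed pair of extended
charts (`mdifferentiableOn_iff`): the chart expression `extChartAt y ∘ f ∘ (extChartAt x).symm` is
complex-differentiable on the open set `(extChartAt x).target ∩ (extChartAt x).symm ⁻¹' (s ∩ f ⁻¹'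
(extChartAt y).source)`, hence `C^n` there by `contDiffOn_of_differentiableOn_complex`
(Chae 14.13 / Osgood), which is `contMDiffOn_iff`.  Voisin (2002), §1.2.1 Thm. 1.17 (holomorphic ⇔
analytic) with §2.2.1 (holomorphic maps of complex manifolds); Gunning–Rossi (1965), Ch. I §A.
[cite: VoisinHodgeI2002, §1.2.1 Thm. 1.17] -/
theorem contMDiffOn_of_mdifferentiableOn [IsManifold 𝓘(ℂ, E) n M] [IsManifold 𝓘(ℂ, E') n M']
    (hf : MDifferentiableOn 𝓘(ℂ, E) 𝓘(ℂ, E') f s) (hs : IsOpen s) :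
    ContMDiffOn 𝓘(ℂ, E) 𝓘(ℂ, E') n f s := by
  rcases eq_or_ne n 0 with rfl | hn
  · exact contMDiffOn_zero_iff.2 hf.continuousOn
  haveI : IsManifold 𝓘(ℂ, E) 1 M := .of_le (one_le_of_ne_zero_withTopENat hn)
  haveI : IsManifold 𝓘(ℂ, E') 1 M' := .of_le (one_le_of_ne_zero_withTopENat hn)
  obtain ⟨hcont, hdiff⟩ := mdifferentiableOn_iff.1 hf
  refine contMDiffOn_iff.2 ⟨hcont, fun x y ↦ contDiffOn_of_differentiableOn_complex (hdiff x y) ?_⟩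
  exact (continuousOn_extChartAt_symm x).isOpen_inter_preimage (isOpen_extChartAt_target x)
    (hcont.isOpen_inter_preimage hs (isOpen_extChartAt_source y))

/-- Pointwise form: if `f` is complex-differentiable at every point of a neighbourhood of `x`, then
`f` is complex-`C^n` at `x` (every `n : ℕ∞ω`). [cite: VoisinHodgeI2002, §1.2.1 Thm. 1.17] -/
theorem contMDiffAt_of_eventually_mdifferentiableAt [IsManifold 𝓘(ℂ, E) n M]
    [IsManifold 𝓘(ℂ, E') n M'] (hf : ∀ᶠ y in 𝓝 x, MDifferentiableAt 𝓘(ℂ, E) 𝓘(ℂ, E') f y) :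
    ContMDiffAt 𝓘(ℂ, E) 𝓘(ℂ, E') n f x := by
  obtain ⟨t, htf, ht, hxt⟩ := eventually_nhds_iff.1 hf
  exact (contMDiffOn_of_mdifferentiableOn (fun y hy ↦ (htf y hy).mdifferentiableWithinAt)
    ht).contMDiffAt (ht.mem_nhds hxt)

/-- Global form, every exponent: a holomorphic map `f : M → M'` (complex-differentiable
everywhere) between manifolds with complex-`C^n` atlases is complex-`C^n`.  (The tree's
`MDifferentiable.contMDiff_of_complex` is the case `n = ∞` under `C^ω` atlases.)
[cite: VoisinHodgeI2002, §1.2.1 Thm. 1.17] -/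
theorem contMDiff_of_mdifferentiable [IsManifold 𝓘(ℂ, E) n M] [IsManifold 𝓘(ℂ, E') n M']
    (hf : MDifferentiable 𝓘(ℂ, E) 𝓘(ℂ, E') f) : ContMDiff 𝓘(ℂ, E) 𝓘(ℂ, E') n f :=
  contMDiffOn_univ.1 (contMDiffOn_of_mdifferentiableOn hf.mdifferentiableOn isOpen_univ)

/-- Source an open subset of the model space (the shape of a uniformisation `ψ : ℂᵐ ⊇ U → X^an`):
a map `f : E → M'` complex-differentiable on an open `U ⊆ E` is complex-`C^n` on `U`, for any
complex-`C^n` atlas on `M'` — the model space `E` carries its canonical one-chart structure.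
A restatement of `contMDiffOn_of_mdifferentiableOn` recorded for discoverability (Voisin (2002),
§1.2.1 Thm. 1.17: holomorphic maps of open sets of `ℂᵐ` are analytic).
[cite: VoisinHodgeI2002, §1.2.1 Thm. 1.17] -/
theorem contMDiffOn_of_mdifferentiableOn_source_model [IsManifold 𝓘(ℂ, E') n M'] {f : E → M'}
    {U : Set E} (hf : MDifferentiableOn 𝓘(ℂ, E) 𝓘(ℂ, E') f U) (hU : IsOpen U) :
    ContMDiffOn 𝓘(ℂ, E) 𝓘(ℂ, E') n f U :=
  contMDiffOn_of_mdifferentiableOn hf hU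

end Manifold

/-! ### The same charts read through the real models `𝓘(ℝ, E)`, `𝓘(ℝ, E')` -/

section Real

variable {E : Type*} [NormedAddCommGroup E] [NormedSpace ℝ E] [NormedSpace ℂ E]
  [IsScalarTower ℝ ℂ E] {E' : Type*} [NormedAddCommGroup E'] [NormedSpace ℝ E'] [NormedSpace ℂ E']
  [IsScalarTower ℝ ℂ E'] [CompleteSpace E']
  {M : Type*} [TopologicalSpace M] [ChartedSpace E M]
  {M' : Type*} [TopologicalSpace M'] [ChartedSpace E' M']
  {n : ℕ∞ω} {f : M → M'} {s : Set M} {x : M}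

/-- **Holomorphic on an open set ⇒ real `C^n` on it, same charts**: under the hypotheses of
`contMDiffOn_of_mdifferentiableOn`, `f` is `C^n` for the REAL models `𝓘(ℝ, E)`, `𝓘(ℝ, E')`
(any compatible real normed structures, `IsScalarTower ℝ ℂ`), by
`Literature.Geometry.Kaehler.contMDiffOn_real_of_complex`.  This is the regularity consumed by the
pull-back calculus of smooth forms (`MForm.pullbackWithin`, `extDeriv` of a pull-back) along a map
that is only known to be holomorphic on an open set.  No real-manifold instance is needed to STATE
`ContMDiffOn` for the real models.  Voisin (2002), §2.2.1; Wells (1980), Ch. I §3.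
[cite: VoisinHodgeI2002, §2.2.1] -/
theorem contMDiffOn_real_of_mdifferentiableOn [IsManifold 𝓘(ℂ, E) n M] [IsManifold 𝓘(ℂ, E') n M']
    (hf : MDifferentiableOn 𝓘(ℂ, E) 𝓘(ℂ, E') f s) (hs : IsOpen s) :
    ContMDiffOn 𝓘(ℝ, E) 𝓘(ℝ, E') n f s :=
  contMDiffOn_real_of_complex (contMDiffOn_of_mdifferentiableOn hf hs)

/-- Pointwise real form: complex-differentiable on a neighbourhood of `x` ⇒ real-`C^n` at `x` for
the same charts. [cite: VoisinHodgeI2002, §2.2.1] -/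
theorem contMDiffAt_real_of_eventually_mdifferentiableAt [IsManifold 𝓘(ℂ, E) n M]
    [IsManifold 𝓘(ℂ, E') n M'] (hf : ∀ᶠ y in 𝓝 x, MDifferentiableAt 𝓘(ℂ, E) 𝓘(ℂ, E') f y) :
    ContMDiffAt 𝓘(ℝ, E) 𝓘(ℝ, E') n f x :=
  contMDiffWithinAt_real_of_complex (contMDiffAt_of_eventually_mdifferentiableAt hf)

/-- Global real form, every exponent: a holomorphic map between manifolds with complex-`C^n`
atlases is real-`C^n` for the same charts.  (The tree's
`MDifferentiable.contMDiff_real_of_complex` is the case `n = ∞` under `C^ω` atlases.)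
[cite: VoisinHodgeI2002, §2.2.1] -/
theorem contMDiff_real_of_mdifferentiable [IsManifold 𝓘(ℂ, E) n M] [IsManifold 𝓘(ℂ, E') n M']
    (hf : MDifferentiable 𝓘(ℂ, E) 𝓘(ℂ, E') f) : ContMDiff 𝓘(ℝ, E) 𝓘(ℝ, E') n f :=
  contMDiffOn_univ.1 (contMDiffOn_real_of_complex
    (contMDiffOn_of_mdifferentiableOn hf.mdifferentiableOn isOpen_univ))

end Real

/-! ### A complex-`C¹` atlas is complex-`C^n` for every `n` -/

section Atlas

variable {E : Type*} [NormedAddCommGroup E] [NormedSpace ℂ E] [CompleteSpace E]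
  {M : Type*} [TopologicalSpace M] [ChartedSpace E M]

/-- **Holomorphic atlases are analytic**: if the transition maps of the atlas of `M` (charts valued
in a complex Banach space `E`, model `𝓘(ℂ, E)`) are complex-`C¹`, they are complex-`C^n` for every
`n : ℕ∞ω`, in particular `C^ω` — a transition map is complex-differentiable on the open set
`(e.symm ≫ₕ e').source`, hence analytic there (`contDiffOn_of_differentiableOn_complex`).  So
`IsManifold 𝓘(ℂ, E) 1 M` already gives `IsManifold 𝓘(ℂ, E) n M`.  Deliberately a theorem and not
an instance (it would loop with `IsManifold.of_le`).  Fritzsche–Grauert (2002), Ch. IV §1;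
Voisin (2002), §1.2.1 Thm. 1.17. [cite: VoisinHodgeI2002, §1.2.1 Thm. 1.17] -/
theorem isManifold_of_isManifold_one_complex [IsManifold 𝓘(ℂ, E) 1 M] (n : ℕ∞ω) :
    IsManifold 𝓘(ℂ, E) n M := by
  have hup : ∀ (g : E → E) (t : Set E), IsOpen t →
      (contDiffPregroupoid 1 𝓘(ℂ, E)).property g t → (contDiffPregroupoid n 𝓘(ℂ, E)).property g t := by
    intro g t ht h
    simp only [contDiffPregroupoid, modelWithCornersSelf_coe, modelWithCornersSelf_coe_symm,
      Function.comp_id, Function.id_comp, preimage_id_eq, id_eq, range_id, inter_univ] at h ⊢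
    exact contDiffOn_of_differentiableOn_complex (h.differentiableOn one_ne_zero) ht
  have hG : HasGroupoid M (contDiffGroupoid n 𝓘(ℂ, E)) := by
    refine ⟨fun {e e'} he he' ↦ ?_⟩
    have h : e.symm ≫ₕ e' ∈ contDiffGroupoid 1 𝓘(ℂ, E) := HasGroupoid.compatible he he'
    rw [contDiffGroupoid, mem_groupoid_of_pregroupoid] at h ⊢
    exact ⟨hup _ _ (e.symm ≫ₕ e').open_source h.1, hup _ _ (e.symm ≫ₕ e').open_target h.2⟩
  exact IsManifold.mk' _ _ _

end Atlas

end Literature.Geometry.Kaehler
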